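import Mathlib
import HarnessLib
import Literature.Barriers.FinalStateConjecture.ExtremalHorizonChargeConservationProofs
import Literature.Geometry.Lorentzian.ChartCalculus
import Literature.Analysis.Calculus.SpherePolynomialDensity
import Literature.Analysis.Calculus.SphereAngularRigidity
import Summits.FinalStateConjecture.FinalStateConjecture.Theorems.EternalPapapetrouSchwarzschildExteriorModeRigiditySphereVanish

/-!
# Route EternalPapapetrou · `SchwarzschildExteriorModeRigidity` (item stmt-FinalStateConjecture-10039)

**Theorem.** For `M > 0`, every smooth `ψ` on the Schwarzschild exterior `Kerr.exterior M 0 = {r > 2M}`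
(ingoing Kerr–Schild chart, metric `Kerr.smoothMetric M 0 r₊`) with `□ψ = 0`, `|ψ| + ‖dψ‖ ≤ C`, and
`r |∂₀ψ| → 0` uniformly in `t*`, satisfies `∂₀ψ ≡ 0` on the whole exterior.

Proof (files `EternalPapapetrouSchwarzschildExteriorModeRigidity*.lean` of this directory):
1. `□_g ψ = 0` in Kerr–Schild coordinates is `∑ g^{μν}∂_μ∂_νf + ∑ c^ν∂_νf = 0` for the extension
   `f` (`Literature.Barriers.FinalStateConjecture.Kerr.dalembertian_eq_hessian_add_firstOrder`), and
   for `a = 0` this is `−(1+2M/r)f_tt + (4M/r)f_tr + (2M/r²)f_t + Δf − (2M/r)f_rr − (2M/r²)f_r = 0`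
   (`schwarzschild_frame_form`).
2. Projecting on the eigenfunctions `G` of the spherical Laplacian (on homogeneous polynomials,
   `Literature.Analysis.Calculus.MvPoly.HomL2.eigenfun`), `u = ∫ G(θ) f(t, rθ) dσ(θ)` is `C²` on the
   strip `r > 2M` and solves the reduced `1+1` system (`sphereMean_pde`), with `u, u_t, u_r` bounded
   and `r u_t → 0` (two-sided non-radiation).
3. The `1+1` Liouville theorem `fderiv_time_eq_zero`: mollify in `t`, band-limit away from the zero
   frequency (inverse-Bernstein kernels, `bernsteinData`), transport the characteristic fields of the
   reduced system from the two ends (`core_eq_zero`), get `ker_R ⋆ u = ker_ε ⋆ u` for `0 < ε ≤ R`,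
   hence `u(·, r)` is constant and `u_t = 0`.
4. `∫ G(θ) ∂₀f(t, rθ) dσ = 0` for all eigenfunctions; these span the restrictions of all polynomials
   (`exists_eq_sum_eigenfun`, `exists_homogenization`), which are dense in `C(S²)`
   (`exists_poly_near_of_continuousOn`), so `∂₀ f(t, r·) = 0` on `S²` for all `(t, r)`.

The statement below is the body of the route decl
`Summit.FinalStateConjecture.FinalStateConjecture.Theses.EternalPapapetrou.SchwarzschildExteriorModeRigidity`
written out verbatim (this file does not import the route module, so that the gate can render the
`_holds` link there without an import cycle); its type unfolds to the route decl by `δ`-reduction.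
[folklore]
-/

set_option linter.dupNamespace false

noncomputable section

namespace Summit.FinalStateConjecture.FinalStateConjecture.Theorems

open scoped BigOperators Topology Manifold Classical MeasureTheory ProbabilityTheory Matrix InnerProductSpace ComplexConjugate ContinuousMap
open Filter Set Function TopologicalSpace MeasureTheory

namespace EternalPapapetrou.ModeRigidity

open Literature.Geometry.Lorentzian Literature.Analysis.Calculus Literature.Analysis.FluidPDE Metric

/-! ### Density: a continuous function on `S²` orthogonal to all eigenfunctions vanishes -/

/-- Orthogonality to the eigenfunctions gives orthogonality to every homogeneous polynomial.
[folklore] -/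
theorem integral_toFun_mul_eq_zero_of_isHomogeneous {F : S2 → ℝ} (hF : Continuous F)
    (horth : ∀ (K : ℕ) (a : Fin (MvPoly.HomL2.dim 3 K)),
      ∫ θ : S2, MvPoly.HomL2.eigenfun (K := K) two_le_three a θ * F θ
        ∂(volume : Measure E3).toSphere = 0)
    {K : ℕ} {Q : MvPolynomial (Fin 3) ℝ} (hQ : Q.IsHomogeneous K) :
    ∫ θ : S2, MvPoly.toFun Q θ * F θ ∂(volume : Measure E3).toSphere = 0 := by
  obtain ⟨c, hc⟩ := MvPoly.HomL2.exists_eq_sum_eigenfun two_le_three (MvPoly.HomL2.mk Q hQ)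
  simp only [MvPoly.HomL2.val_mk] at hc
  have hint : ∀ a : Fin (MvPoly.HomL2.dim 3 K), Integrable (fun θ : S2 ↦
      c a * MvPoly.HomL2.eigenfun (K := K) two_le_three a θ * F θ)
      (volume : Measure E3).toSphere :=
    fun a ↦ ((continuous_const.mul ((continuous_Gf a).comp continuous_subtype_val)).mul hF)
      |>.integrable_of_hasCompactSupport (HasCompactSupport.of_compactSpace _)
  simp_rw [hc, Finset.sum_mul]
  rw [integral_finsetSum _ fun a _ ↦ hint a]
  refine Finset.sum_eq_zero fun a _ ↦ ?_
  simp_rw [mul_assoc]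
  rw [integral_const_mul, horth K a, mul_zero]

/-- Orthogonality to every polynomial. [folklore] -/
theorem integral_toFun_mul_eq_zero {F : S2 → ℝ} (hF : Continuous F)
    (horth : ∀ (K : ℕ) (a : Fin (MvPoly.HomL2.dim 3 K)),
      ∫ θ : S2, MvPoly.HomL2.eigenfun (K := K) two_le_three a θ * F θ
        ∂(volume : Measure E3).toSphere = 0)
    (P : MvPolynomial (Fin 3) ℝ) :
    ∫ θ : S2, MvPoly.toFun P θ * F θ ∂(volume : Measure E3).toSphere = 0 := by
  obtain ⟨q₁, q₂, hq₁, hq₂, hP⟩ := MvPoly.exists_homogenization P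
  have heq : ∀ θ : S2, MvPoly.toFun P θ * F θ =
      MvPoly.toFun q₁ θ * F θ + MvPoly.toFun q₂ θ * F θ := fun θ ↦ by
    rw [hP θ (norm_eq_of_mem_sphere θ), add_mul]
  have hint : ∀ q : MvPolynomial (Fin 3) ℝ, Integrable (fun θ : S2 ↦ MvPoly.toFun q θ * F θ)
      (volume : Measure E3).toSphere := fun q ↦
    (((MvPoly.contDiff_toFun q (m := 0)).continuous.comp continuous_subtype_val).mul hF)
      |>.integrable_of_hasCompactSupport (HasCompactSupport.of_compactSpace _)
  rw [integral_congr_ae (Eventually.of_forall heq), integral_add (hint q₁) (hint q₂),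
    integral_toFun_mul_eq_zero_of_isHomogeneous hF horth hq₁,
    integral_toFun_mul_eq_zero_of_isHomogeneous hF horth hq₂, add_zero]

/-- **Density**: a function continuous off the origin whose restriction to `S²` is orthogonal to
all eigenfunctions vanishes on `S²` (polynomials are dense in `C(S²)`). [folklore] -/
theorem eq_zero_of_orthogonal_eigenfun {F : E3 → ℝ} (hF : ContinuousOn F {0}ᶜ)
    (horth : ∀ (K : ℕ) (a : Fin (MvPoly.HomL2.dim 3 K)),
      ∫ θ : S2, MvPoly.HomL2.eigenfun (K := K) two_le_three a θ * F θ
        ∂(volume : Measure E3).toSphere = 0) :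
    ∀ θ : S2, F θ = 0 := by
  have hFθ : Continuous fun θ : S2 ↦ F θ :=
    hF.comp_continuous continuous_subtype_val fun θ ↦ ne_zero_of_mem_unit_sphere θ
  obtain ⟨B, hB⟩ := (isCompact_univ (X := S2)).exists_bound_of_continuousOn hFθ.continuousOn
  set m := (volume : Measure E3).toSphere.real (univ : Set S2) with hm
  have hm0 : 0 ≤ m := measureReal_nonneg
  have θ₁ : S2 := ⟨EuclideanSpace.single 0 1, by simp⟩
  have hB0 : 0 ≤ B := (norm_nonneg _).trans (hB θ₁ (mem_univ _))
  have hBabs : ∀ θ : S2, |F θ| ≤ B := fun θ ↦ (Real.norm_eq_abs _).symm.le.trans (hB θ (mem_univ _))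
  have iFF : Integrable (fun θ : S2 ↦ F θ * F θ) (volume : Measure E3).toSphere :=
    (hFθ.mul hFθ).integrable_of_hasCompactSupport (HasCompactSupport.of_compactSpace _)
  -- `∫ F² ≤ B m ε` for every `ε > 0`
  have key : ∀ ε > (0 : ℝ), ∫ θ : S2, F θ * F θ ∂(volume : Measure E3).toSphere ≤ B * ε * m := by
    intro ε hε
    obtain ⟨P, hP⟩ := MvPoly.exists_poly_near_of_continuousOn hF hε
    have h0 : ∫ θ : S2, MvPoly.toFun P θ * F θ ∂(volume : Measure E3).toSphere = 0 :=
      integral_toFun_mul_eq_zero hFθ horth P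
    have hPc : Continuous fun θ : S2 ↦ MvPoly.toFun P θ :=
      (MvPoly.contDiff_toFun P (m := 0)).continuous.comp continuous_subtype_val
    have i1 : Integrable (fun θ : S2 ↦ F θ * (F θ - MvPoly.toFun P θ))
        (volume : Measure E3).toSphere :=
      (hFθ.mul (hFθ.sub hPc)).integrable_of_hasCompactSupport (HasCompactSupport.of_compactSpace _)
    have i2 : Integrable (fun θ : S2 ↦ MvPoly.toFun P θ * F θ) (volume : Measure E3).toSphere :=
      (hPc.mul hFθ).integrable_of_hasCompactSupport (HasCompactSupport.of_compactSpace _)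
    have hsplit : ∫ θ : S2, F θ * F θ ∂(volume : Measure E3).toSphere =
        ∫ θ : S2, F θ * (F θ - MvPoly.toFun P θ) ∂(volume : Measure E3).toSphere +
          ∫ θ : S2, MvPoly.toFun P θ * F θ ∂(volume : Measure E3).toSphere := by
      rw [← integral_add i1 i2]
      exact integral_congr_ae (Eventually.of_forall fun θ ↦ by ring)
    rw [hsplit, h0, add_zero]
    exact (le_abs_self _).trans (abs_integral_mul_le hBabs
      (fun θ ↦ (hP θ (norm_eq_of_mem_sphere θ)).le) hB0)
  -- hence `∫ F² = 0`
  have hsq : ∫ θ : S2, F θ * F θ ∂(volume : Measure E3).toSphere = 0 := by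
    refine le_antisymm ?_ (integral_nonneg fun θ ↦ mul_self_nonneg _)
    refine le_of_forall_pos_le_add fun ε hε ↦ ?_
    have hden : 0 < B * m + 1 := add_pos_of_nonneg_of_pos (mul_nonneg hB0 hm0) one_pos
    have h := key (ε / (B * m + 1)) (div_pos hε hden)
    calc ∫ θ : S2, F θ * F θ ∂(volume : Measure E3).toSphere ≤ B * (ε / (B * m + 1)) * m := h
      _ = B * m / (B * m + 1) * ε := by field_simp
      _ ≤ 1 * ε := by
          gcongr
          rw [div_le_one hden]
          linarith
      _ = 0 + ε := by ring
  -- and `F = 0` on `S²`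
  have h := eq_zero_on_sphere_of_sphereIntegral_sq_eq_zero (E := E3) hF one_pos (by
    rw [sphereIntegral_def]
    simp only [one_smul, sq]
    exact hsq)
  exact fun θ ↦ h θ (norm_eq_of_mem_sphere θ)

/-! ### The theorem -/

/-- Normalising a nonzero vector lands on the unit sphere. [folklore] -/
theorem norm_inv_smul_eq_one {v : E3} (hv : v ≠ 0) : ‖‖v‖⁻¹ • v‖ = 1 := by
  rw [norm_smul, norm_inv, norm_norm, inv_mul_cancel₀ (norm_ne_zero_iff.2 hv)]

end EternalPapapetrou.ModeRigidity

open EternalPapapetrou.ModeRigidity Literature.Geometry.Lorentzian Literature.Analysis.Calculus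
  Literature.Analysis.FluidPDE Metric in
/-- **Schwarzschild exterior mode rigidity** (item stmt-FinalStateConjecture-10039, route
EternalPapapetrou): for `M > 0`, a smooth solution `ψ` of `□ψ = 0` on the Schwarzschild exterior
`Kerr.exterior M 0` with `|ψ|, ‖dψ‖ ≤ C` and `r |∂₀ψ| → 0` uniformly in `t*` has `∂₀ψ ≡ 0`.
The statement is the body of the route decl `…Theses.EternalPapapetrou.SchwarzschildExteriorModeRigidity`,
verbatim. [folklore] -/
theorem EternalPapapetrou.schwarzschildExteriorModeRigidity_proof :
    ∀ (M C : ℝ), 0 < M → ∀ [Literature.Geometry.Lorentzian.Kerr.Facts] [Literature.Geometry.Lorentzian.Kerr.SliceFacts] (ψ : Literature.Geometry.Lorentzian.Kerr.exterior M 0 → ℝ), ContMDiff 𝓘(ℝ, Literature.Geometry.Lorentzian.E4) 𝓘(ℝ, ℝ) (⊤ : ℕ∞) ψ → (∀ x, (Literature.Geometry.Lorentzian.Kerr.smoothMetric M 0 (Literature.Geometry.Lorentzian.Kerr.rPlus M 0)).toPseudoRiemannianMetric.dalembertian ψ x = 0) → let f : Literature.Geometry.Lorentzian.E4 → ℝ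 := Function.extend Subtype.val ψ 0; (∀ x : Literature.Geometry.Lorentzian.Kerr.exterior M 0, |f x.1| ≤ C ∧ ‖fderiv ℝ f x.1‖ ≤ C) → (∀ δ > (0 : ℝ), ∃ R' : ℝ, ∀ x : Literature.Geometry.Lorentzian.Kerr.exterior M 0, R' < Literature.Geometry.Lorentzian.Kerr.radius 0 x.1 → |fderiv ℝ f x.1 (Literature.Geometry.Lorentzian.E4.basisVector 0)| * Literature.Geometry.Lorentzian.Kerr.radius 0 x.1 ≤ δ) → ∀ x : Literature.Geometry.Lorentzian.Kerr.exterior M 0, fderiv ℝ f x.1 (Literature.Geometry.Lorentzian.E4.basisVector 0) = 0 := by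
  intro M C hM _ _ ψ hψ hbox f hbd hrad x
  have h2M : 0 < 2 * M := by linarith
  -- membership in the exterior
  have hmem : ∀ y : E4, y ∈ (Kerr.exterior M 0 : Opens E4) ↔ 2 * M < ‖E4.spatial y‖ := by
    intro y
    rw [Kerr.mem_exterior, Kerr.rPlus_zero_right hM.le, max_eq_left h2M.le,
      Kerr.radius_zero_eq_norm_spatial]
  have hrad0 : ∀ y : E4, Kerr.radius 0 y = ‖E4.spatial y‖ := Kerr.radius_zero_eq_norm_spatial
  -- the representative
  have hrep : ∀ y : Kerr.exterior M 0, ψ y = f y :=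
    fun y ↦ (Subtype.val_injective.extend_apply _ _ y).symm
  have hf2 : ∀ y : E4, ∀ hy : 2 * M < ‖E4.spatial y‖, ContDiffAt ℝ 2 f y := fun y hy ↦
    ((OpensChart.contMDiffAt_iff (⟨y, (hmem y).2 hy⟩ : Kerr.exterior M 0) ψ f hrep).mp
      (hψ _)).of_le (WithTop.coe_le_coe.mpr le_top)
  have hfC : ContDiffOn ℝ 2 f {y : E4 | 2 * M < ‖E4.spatial y‖} :=
    fun y hy ↦ (hf2 y hy).contDiffWithinAt
  -- the wave equation in coordinates
  have hW : ∀ y : E4, 2 * M < ‖E4.spatial y‖ →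
      ∑ μ, ∑ ν, Kerr.inverseMetric M 0 y μ ν *
          fderiv ℝ (fderiv ℝ f) y (E4.basisVector μ) (E4.basisVector ν) +
        ∑ ν, Kerr.divInverseMetric M 0 y ν * fderiv ℝ f y (E4.basisVector ν) = 0 := by
    intro y hy
    have h := Literature.Barriers.FinalStateConjecture.Kerr.dalembertian_eq_hessian_add_firstOrder
      M 0 (Kerr.rPlus M 0) hrep ⟨y, (hmem y).2 hy⟩ (hf2 y hy)
    rw [hbox] at h
    exact h.symm
  -- bounds and non-radiation, in coordinates
  have hbΦ : ∀ y : E4, 2 * M < ‖E4.spatial y‖ → |f y| ≤ C ∧ ‖fderiv ℝ f y‖ ≤ C :=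
    fun y hy ↦ hbd ⟨y, (hmem y).2 hy⟩
  have hradΦ : ∀ δ > (0 : ℝ), ∃ R', ∀ y : E4, 2 * M < ‖E4.spatial y‖ → R' < ‖E4.spatial y‖ →
      |fderiv ℝ f y (E4.basisVector 0)| * ‖E4.spatial y‖ ≤ δ := by
    intro δ hδ
    obtain ⟨R', hR'⟩ := hrad δ hδ
    refine ⟨R', fun y hy hR ↦ ?_⟩
    have h := hR' ⟨y, (hmem y).2 hy⟩ (by rw [hrad0]; exact hR)
    rwa [hrad0] at h
  -- the point `x = (t, r θ₀)`
  set y : E4 := x.1 with hy_def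
  have hy : 2 * M < ‖E4.spatial y‖ := (hmem y).1 x.2
  set r : ℝ := ‖E4.spatial y‖ with hr_def
  have hr : 0 < r := lt_trans h2M hy
  have hsp : E4.spatial y ≠ 0 := norm_ne_zero_iff.1 hr.ne'
  set p : ℝ × ℝ := (E4.time y, r) with hp_def
  have hp : p ∈ strip M := ⟨mem_univ _, hy⟩
  let θ₀ : S2 := ⟨r⁻¹ • E4.spatial y, by
    rw [mem_sphere_zero_iff_norm]; exact norm_inv_smul_eq_one hsp⟩
  have hspt : spt p θ₀ = y := by
    show (E4.time y) • E4.basisVector 0 + r • E4.spaceEmbed (r⁻¹ • E4.spatial y) = y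
    rw [map_smul, smul_smul, mul_inv_cancel₀ hr.ne', one_smul, ← E4.ofTimeSpace_eq_smul_add',
      E4.ofTimeSpace_time_spatial]
  -- the continuous function `θ ↦ ∂₀f(t, rθ)` on the punctured space
  set F : E3 → ℝ := fun v ↦ fderiv ℝ f (spt p (‖v‖⁻¹ • v)) (E4.basisVector 0) with hF_def
  have hn : ContinuousOn (fun v : E3 ↦ ‖v‖⁻¹ • v) {0}ᶜ :=
    (continuousOn_id.norm.inv₀ fun v hv ↦ norm_ne_zero_iff.2 hv).smul continuousOn_id
  have hmaps : ∀ v : E3, v ≠ 0 → spt p (‖v‖⁻¹ • v) ∈ {z : E4 | 2 * M < ‖E4.spatial z‖} := by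
    intro v hv
    show 2 * M < ‖E4.spatial (spt p (‖v‖⁻¹ • v))‖
    rw [spatial_spt, norm_smul, norm_inv_smul_eq_one hv, mul_one, Real.norm_eq_abs,
      abs_of_pos hr]
    exact hy
  have hFc : ContinuousOn F {0}ᶜ := by
    have h2 : ContinuousOn (fun v : E3 ↦ spt p (‖v‖⁻¹ • v)) {0}ᶜ :=
      continuous_spt.comp_continuousOn (continuousOn_const.prodMk hn)
    have h3 : ContinuousOn (fderiv ℝ f) {z : E4 | 2 * M < ‖E4.spatial z‖} :=
      hfC.continuousOn_fderiv_of_isOpen (isOpen_exteriorSet M) (by norm_num)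
    exact (h3.comp h2 fun v hv ↦ hmaps v hv).clm_apply continuousOn_const
  have hFθ : ∀ θ : S2, F θ = fderiv ℝ f (spt p θ) (E4.basisVector 0) := fun θ ↦ by
    simp only [hF_def, norm_eq_of_mem_sphere θ, inv_one, one_smul]
  have horth : ∀ (K : ℕ) (a : Fin (MvPoly.HomL2.dim 3 K)),
      ∫ θ : S2, MvPoly.HomL2.eigenfun (K := K) two_le_three a θ * F θ
        ∂(volume : Measure E3).toSphere = 0 := by
    intro K a
    simp_rw [hFθ]
    exact integral_eigenfun_mul_timeDeriv_eq_zero hM hfC hW hbΦ hradΦ a hp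
  have h0 := eq_zero_of_orthogonal_eigenfun hFc horth θ₀
  rw [hFθ θ₀, hspt] at h0
  exact h0


end Summit.FinalStateConjecture.FinalStateConjecture.Theorems
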